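import Literature.Probability.RandomPlanarGeometry.SLELawPointAvoidance
import Mathlib.MeasureTheory.Measure.Lebesgue.Complex
import HarnessLib

/-!
# The range of chordal SLE_κ is Lebesgue-null almost surely, `4 < κ < 8`

Topic `Probability/RandomPlanarGeometry`; theorems only. The law-level point avoidance of
Rohde–Schramm (`IsSLELaw.ae_notMem_range`: for `4 < κ < 8` and every fixed `w ≠ a, b`, `μ`-a.e.
curve class of the chordal SLE_κ law `μ` of a Dobrushin domain `(D; a, b)` misses `w`) is upgraded
by Tonelli to: **`μ`-a.e. curve class has a trace of planar Lebesgue measure zero**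
(`IsSLELaw.ae_volume_range_eq_zero`). No regularity of `∂D` is used (the exceptional fixed points
are only `a` and `b`), so the statement holds in every Dobrushin domain, Osgood-type Jordan
curves of positive area included.

The curve-space part is generic (`E` a metric space, `CurveClass E` the Aizenman–Burchard space
of curves modulo reparametrisation of `CurveSpace.lean`):

* `CurveClass.infDist_range_le_infDist_range_add_dist` — `dist(w, trace γ') ≤ dist(w, trace γ) +
  dist γ γ'` (every point of one trace is within `dist γ γ'` of the other,
  `Curve.infDist_range_le`); hence `(γ, w) ↦ dist(w, trace γ)` is `2`-Lipschitz on
  `CurveClass E × E` (`CurveClass.lipschitzWith_infDist_range_prod`) and the incidence set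
  `{(γ, w) | w ∈ trace γ}` is closed (`CurveClass.isClosed_setOf_snd_mem_range`; traces are
  compact), hence Borel for `E` second countable;
* `CurveClass.measurable_measure_range` — `γ ↦ ν (trace γ)` is measurable for every s-finite
  `ν`; `CurveClass.lintegral_measure_range` — Tonelli:
  `∫⁻ γ, ν (trace γ) ∂μ = ∫⁻ w, μ {γ | w ∈ trace γ} ∂ν`;
* `CurveClass.ae_measure_range_eq_zero` — if every fixed point off a `ν`-null set is `μ`-a.s.
  avoided, then `ν (trace γ) = 0` for `μ`-a.e. `γ`.

Mathlib: `Measure.prod_apply`, `Measure.prod_apply_symm`, `measurable_measure_prodMk_left`,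
`lintegral_eq_zero_iff`, `LipschitzWith.of_le_add_mul`, `IsClosed.mem_iff_infDist_zero`,
`Set.Finite.measure_zero` (Lebesgue measure on `ℂ` has no atoms).

Deliberately NOT here: the case `κ ≤ 4` (simple trace; a Hausdorff-dimension proof is in
`Literature/Barriers/CriticalPhenomena/SupercriticalSAWSpaceFillingDensityNecessary.lean`) and
`κ ≥ 8` (space-filling, the statement is false).

References: S. Rohde, O. Schramm, *Basic properties of SLE*, Ann. of Math. 161 (2005), Thm. 6.4;
M. Aizenman, A. Burchard, Duke Math. J. 99 (1999), §2.1.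
-/

noncomputable section

open Set Filter MeasureTheory Metric
open scoped NNReal ENNReal Topology

namespace Literature.Probability.RandomPlanarGeometry

/-! ### The incidence set `{(γ, w) | w ∈ trace γ}` is closed -/

section MetricSpace

variable {E : Type*} [MetricSpace E]

/-- The distance from a fixed point to the trace is `1`-Lipschitz in the curve class:
`dist(w, trace γ') ≤ dist(w, trace γ) + dist γ γ'`, because every point of `trace γ` is within
`dist γ γ'` of `trace γ'` (Aizenman–Burchard 1999, §2.1). [cite: AizenmanBurchard1999, §2.1] -/
theorem CurveClass.infDist_range_le_infDist_range_add_dist (γ γ' : CurveClass E) (w : E) :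
    infDist w γ'.range ≤ infDist w γ.range + dist γ γ' := by
  obtain ⟨c, rfl⟩ := CurveClass.surjective_mk γ
  obtain ⟨c', rfl⟩ := CurveClass.surjective_mk γ'
  rw [CurveClass.range_mk, CurveClass.range_mk, CurveClass.dist_mk_mk, ← sub_le_iff_le_add]
  refine (le_infDist c.range_nonempty).2 ?_
  rintro _ ⟨t, rfl⟩
  have h1 : infDist w c'.range ≤ infDist (c t) c'.range + dist w (c t) :=
    infDist_le_infDist_add_dist
  have h2 := Curve.infDist_range_le c c' t
  linarith

/-- The distance from a point to the trace, `(γ, w) ↦ dist(w, trace γ)`, is `2`-Lipschitz on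
`CurveClass E × E` (sup distance on the product). [folklore] -/
theorem CurveClass.lipschitzWith_infDist_range_prod :
    LipschitzWith 2 (fun p : CurveClass E × E => infDist p.2 p.1.range) := by
  refine LipschitzWith.of_le_add_mul 2 fun p q => ?_
  have h1 : infDist p.2 p.1.range ≤ infDist q.2 p.1.range + dist p.2 q.2 :=
    infDist_le_infDist_add_dist
  have h2 : infDist q.2 p.1.range ≤ infDist q.2 q.1.range + dist q.1 p.1 :=
    CurveClass.infDist_range_le_infDist_range_add_dist q.1 p.1 q.2
  have h3 : dist p.1 q.1 ≤ dist p q := by rw [Prod.dist_eq]; exact le_max_left _ _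
  have h4 : dist p.2 q.2 ≤ dist p q := by rw [Prod.dist_eq]; exact le_max_right _ _
  rw [dist_comm q.1 p.1] at h2
  simp only [NNReal.coe_ofNat]
  linarith

/-- `(γ, w) ↦ dist(w, trace γ)` is jointly continuous on `CurveClass E × E`. [folklore] -/
theorem CurveClass.continuous_infDist_range_prod :
    Continuous (fun p : CurveClass E × E => infDist p.2 p.1.range) :=
  CurveClass.lipschitzWith_infDist_range_prod.continuous

/-- **The incidence set `{(γ, w) | w ∈ trace γ}` is closed** in `CurveClass E × E`: it is the zero
set of the continuous function `(γ, w) ↦ dist(w, trace γ)`, traces being compact and nonempty.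
[folklore] -/
theorem CurveClass.isClosed_setOf_snd_mem_range :
    IsClosed {p : CurveClass E × E | p.2 ∈ p.1.range} := by
  have : {p : CurveClass E × E | p.2 ∈ p.1.range} =
      (fun p : CurveClass E × E => infDist p.2 p.1.range) ⁻¹' {0} := by
    ext p
    exact p.1.isCompact_range.isClosed.mem_iff_infDist_zero p.1.range_nonempty
  rw [this]
  exact isClosed_singleton.preimage CurveClass.continuous_infDist_range_prod

/-! ### Measurability of `γ ↦ ν (trace γ)` and Tonelli -/

variable [SecondCountableTopology E] [MeasurableSpace E] [BorelSpace E]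

/-- The incidence set `{(γ, w) | w ∈ trace γ}` is Borel in `CurveClass E × E` (`E` second
countable, so that the product Borel structure is the Borel structure of the product). [folklore] -/
theorem CurveClass.measurableSet_setOf_snd_mem_range :
    MeasurableSet {p : CurveClass E × E | p.2 ∈ p.1.range} :=
  CurveClass.isClosed_setOf_snd_mem_range.measurableSet

/-- **`γ ↦ ν (trace γ)` is measurable** on `CurveClass E`, for every s-finite measure `ν` on `E`
(the sections of a measurable subset of a product have measurably varying measure). [folklore] -/
theorem CurveClass.measurable_measure_range (ν : Measure E) [SFinite ν] :
    Measurable fun γ : CurveClass E => ν γ.range :=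
  measurable_measure_prodMk_left CurveClass.measurableSet_setOf_snd_mem_range

/-- **Tonelli for the incidence set**: `∫⁻ γ, ν (trace γ) ∂μ = ∫⁻ w, μ {γ | w ∈ trace γ} ∂ν` for
s-finite `μ`, `ν` (both sides are `(μ ⊗ ν) {(γ, w) | w ∈ trace γ}`). [folklore] -/
theorem CurveClass.lintegral_measure_range (μ : Measure (CurveClass E)) [SFinite μ]
    (ν : Measure E) [SFinite ν] :
    ∫⁻ γ, ν γ.range ∂μ = ∫⁻ w, μ {γ | w ∈ γ.range} ∂ν := by
  have h1 : μ.prod ν {p : CurveClass E × E | p.2 ∈ p.1.range} = ∫⁻ γ, ν γ.range ∂μ :=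
    Measure.prod_apply CurveClass.measurableSet_setOf_snd_mem_range
  have h2 : μ.prod ν {p : CurveClass E × E | p.2 ∈ p.1.range} = ∫⁻ w, μ {γ | w ∈ γ.range} ∂ν :=
    Measure.prod_apply_symm CurveClass.measurableSet_setOf_snd_mem_range
  rw [← h1, h2]

/-- **A random curve avoiding almost every fixed point almost surely has a `ν`-null trace almost
surely**: if `ν N = 0` and `μ`-a.e. `γ` misses `w` for every `w ∉ N`, then `ν (trace γ) = 0` for
`μ`-a.e. `γ` (`μ`, `ν` s-finite; Tonelli). [folklore] -/
theorem CurveClass.ae_measure_range_eq_zero {μ : Measure (CurveClass E)} [SFinite μ]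
    {ν : Measure E} [SFinite ν] {N : Set E} (hN : ν N = 0)
    (h : ∀ w ∉ N, ∀ᵐ γ ∂μ, w ∉ γ.range) : ∀ᵐ γ ∂μ, ν γ.range = 0 := by
  refine (lintegral_eq_zero_iff (CurveClass.measurable_measure_range ν)).1 ?_
  rw [CurveClass.lintegral_measure_range μ ν]
  have hae : (fun w => μ {γ : CurveClass E | w ∈ γ.range}) =ᵐ[ν] 0 := by
    filter_upwards [measure_eq_zero_iff_ae_notMem.1 hN] with w hw
    exact measure_eq_zero_iff_ae_notMem.2 (h w hw)
  rw [lintegral_congr_ae hae, lintegral_zero_fun]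

end MetricSpace

/-! ### The SLE statement -/

variable {κ : ℝ≥0} {D : DobrushinDomain}

/-- **The range of chordal SLE_κ in a Dobrushin domain is Lebesgue-null almost surely,
`4 < κ < 8`**: for an SLE_κ law `μ` of `(D; a, b)`, `volume (trace γ) = 0` for `μ`-a.e. curve
class `γ`. Proof: every fixed `w ∉ {a, b}` is a.s. avoided (Rohde–Schramm 2005, Thm. 6.4, law
level `IsSLELaw.ae_notMem_range`), `{a, b}` is Lebesgue-null, and Tonelli
(`CurveClass.ae_measure_range_eq_zero`; `μ` is a probability measure). [cite: RohdeSchramm2005, Thm 6.4] -/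
theorem IsSLELaw.ae_volume_range_eq_zero (hκ4 : 4 < κ) (hκ8 : κ < 8)
    {μ : Measure (CurveClass ℂ)} (hμ : IsSLELaw κ D μ) : ∀ᵐ γ ∂μ, volume γ.range = 0 := by
  haveI : Fact Process.isProjectiveLimit_preWienerMeasure :=
    ⟨isProjectiveLimit_preWienerMeasure_holds⟩
  haveI := hμ.isProbabilityMeasure
  refine CurveClass.ae_measure_range_eq_zero
    ((Set.toFinite {D.pt 0, D.pt 1}).measure_zero volume) fun w hw => ?_
  simp only [mem_insert_iff, mem_singleton_iff, not_or] at hw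
  exact hμ.ae_notMem_range hκ4 hκ8 hw.1 hw.2

end Literature.Probability.RandomPlanarGeometry

end
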